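import Summits.KontsevichZagierPeriods.Zeta5Search.LaiSweepShard

/-!
# `κ₃` sweep certificate — shard file 110 of 127 (shards 770–776 of 889)

HONEST FRAMING. Systematic search; no irrationality claim unless certified. This file only checks,
by `decide +kernel`, shards 770–776 of the order-cell sweep of the `κ₃` point `(74, 2180, 444; δ74)`
(engine `LaiSweepEngine`, soundness `LaiSweepJump/Free/Eval/Shard/Kappa3`; a shard is `⟨regime, n,
p, q, p', q', Lo, Up⟩`: `n` cells from `p/q` to `p'/q'` with integer rate sums in `[Lo, Up]`, `K =
128`, `D = 2^40`). It draws NO conclusion: only the capstone `LaiKappa3SweepCert`, which needs all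
127 shard files, does. Kernel cost of this file ≈ 560 cells × 0.3 s.
-/

namespace Summit.KontsevichZagierPeriods.Zeta5Search.Sweep

set_option maxHeartbeats 100000000 in
/-- Shard 770: 80 cells of regime B from `268/315` to `357/419`.
[cite: Lai2024BallRivoal, §4 Lemma 4.3] -/
theorem shard770 :
    Shard.check 128 (2^40)
      ⟨true, 80, 268, 315, 357, 419, 10583358877687, 17173590516960⟩ = true := by
  decide +kernel

set_option maxHeartbeats 100000000 in
/-- Shard 771: 80 cells of regime B from `357/419` to `221/259`.
[cite: Lai2024BallRivoal, §4 Lemma 4.3] -/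
theorem shard771 :
    Shard.check 128 (2^40)
      ⟨true, 80, 357, 419, 221, 259, 10729270225821, 17428361522296⟩ = true := by
  decide +kernel

set_option maxHeartbeats 100000000 in
/-- Shard 772: 80 cells of regime B from `221/259` to `323/378`.
[cite: Lai2024BallRivoal, §4 Lemma 4.3] -/
theorem shard772 :
    Shard.check 128 (2^40)
      ⟨true, 80, 221, 259, 323, 378, 10399468977043, 16909976036802⟩ = true := by
  decide +kernel

set_option maxHeartbeats 100000000 in
/-- Shard 773: 80 cells of regime B from `323/378` to `89/104`.
[cite: Lai2024BallRivoal, §4 Lemma 4.3] -/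
theorem shard773 :
    Shard.check 128 (2^40)
      ⟨true, 80, 323, 378, 89, 104, 10871458889718, 17695727627931⟩ = true := by
  decide +kernel

set_option maxHeartbeats 100000000 in
/-- Shard 774: 80 cells of regime B from `89/104` to `353/412`.
[cite: Lai2024BallRivoal, §4 Lemma 4.3] -/
theorem shard774 :
    Shard.check 128 (2^40)
      ⟨true, 80, 89, 104, 353, 412, 8771617974705, 14291371008863⟩ = true := by
  decide +kernel

set_option maxHeartbeats 100000000 in
/-- Shard 775: 80 cells of regime B from `353/412` to `303/353`.
[cite: Lai2024BallRivoal, §4 Lemma 4.3] -/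
theorem shard775 :
    Shard.check 128 (2^40)
      ⟨true, 80, 353, 412, 303, 353, 13314446219856, 21716827616168⟩ = true := by
  decide +kernel

set_option maxHeartbeats 100000000 in
/-- Shard 776: 80 cells of regime B from `303/353` to `251/292`.
[cite: Lai2024BallRivoal, §4 Lemma 4.3] -/
theorem shard776 :
    Shard.check 128 (2^40)
      ⟨true, 80, 303, 353, 251, 292, 10507651308174, 17158187928249⟩ = true := by
  decide +kernel

/-- The checked shards of this file, in order. [folklore] -/
def shards110 : List (CheckedShard 128 (2^40)) :=
  [⟨_, shard770⟩, ⟨_, shard771⟩, ⟨_, shard772⟩, ⟨_, shard773⟩, ⟨_, shard774⟩,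
    ⟨_, shard775⟩, ⟨_, shard776⟩]

end Summit.KontsevichZagierPeriods.Zeta5Search.Sweep
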